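import Summits.BirchSwinnertonDyer.BirchSwinnertonDyer.Theorems.PrintCFramBottomClassIndexLawFiveLeCuspSeedVehicle
import Summits.BirchSwinnertonDyer.BirchSwinnertonDyer.Theorems.PrintCFramBottomClassIndexLawFiveLeCuspSeedThetaJacobi
import Summits.BirchSwinnertonDyer.BirchSwinnertonDyer.Theorems.PrintCFramBottomClassIndexLawFiveLeCohenCutCarlitzLevelOne
import Summits.BirchSwinnertonDyer.BirchSwinnertonDyer.Theorems.PrintCFramBottomClassIndexLawFiveLeCohenCutSeries
import Summits.BirchSwinnertonDyer.BirchSwinnertonDyer.Theorems.PrintCFramBottomClassIndexLawFiveLeCuspSeedCutForm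
import HarnessLib

set_option autoImplicit false

/-!
# Crux `PrintCFram.BottomClassIndexLawFiveLe` (stmt-BirchSwinnertonDyer-20372), line `eisenstein-resource-bdp-line` (registry v25):
# CUSP-GLUE (ζ) — THE CUSP CONJUNCT (iii) OF `stub_cuspCutForm` FROM ITS SOCKETS: «`−(Y.map ι) = 0 ⟹ ∀ x : ℤ_p, ↑x = ↑C → ι x = 0`»
# for ONE class datum, composing the landed pieces BY NAME and taking the three pieces still in flight as HYPOTHESES in their
# announced shapes (cell `bsd-print-cfram`, width seat `bsd-line-cfram-p1-w8` g8; THEOREMS ONLY, `--supports` 20372; BSD is not proved by any of this)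

HONEST FRAMING. Nothing here is a statement about elliptic curves or BSD; no registered stub is closed. This is the cusp twin of
LEAD g13's `CutFormAssembly.cutForm_tuple_of_sockets` (p695510): the END-TO-END composition of conjunct (iii) of registry v24/v25's
`stub_cuspCutForm` for the canonical `G := −(Y.map ι)` (`Y` = the `ℤ_p`-integral cut Cohen series of w4 g12's `CohenCut.exists_cutSeries`),
from
* LANDED, by name: NF-A (cite-only) through (δ) `CuspGlue.exists_cuspVehicle` / `qExpansion_smul_coeff_mem` / `valueAtInfty_smul_slash`
  (p698335); NF-Q (cite-only) through (γ) `CuspGlue.exists_isIntegral_valueAtInfty_slash_of_qExpansion_one` and the end of the chain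
  `CuspGlue.cuspConjunct_of_sq_eq` (p696937); (α) `CuspGlue.tendsto_rpow_smul_tsum_of_eq_mul_thetaMul` (p697177); (E4)
  `CuspSeed.tendsto_sub_mul_LSeries_of_tendsto_rpow_smul_tsum` (w5 g6, p695659); Mathlib `tendsto_nhds_unique`;
* HYPOTHESES (announced, in flight at 05:3xZ 2026-08-29): (hINT) seat w7 g6's integrality socket «on the cut, `‖H(k,a)‖_p < 1 ⟹
  (2A)^j·(A·H(k,a)/p) ∈ ℤ`» (A = 1 for `m ≠ 1`: `CohenCut.exists_eq_prime_mul_cohenH_of_cut_of_norm_lt_one`, p697337; File 3 for `m = 1`);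
  (hsum)+(hR) seat w5 g6's (R2)/(R4) «the cut Cohen `L`-series converges for `Re s > k + 1/2` and `(s − (k+1/2))·L(s) → R`»; (hβ) seat
  w2 g13's (β) part 2 «Lemma A ∘ (α) ∘ [(E4) = (E3)] ⟹ `∃ u ∈ ℚ^×`, `v_p(u) = 0`, `v² = u·C²`», ABSTRACTED over the residue `R` so
  that the instantiation is by their theorem whatever its final spelling of `R`.
Then `cuspConjunct_of_sockets` : `−(Y.map ι) = 0 → ∀ x : ℤ_[p], ↑x = ↑C → ι x = 0` with `C` the REGISTERED rational
`bernoulli (2k)/k! · m^(k−1) · ∏_{q ∈ m.primeFactors} (q−1)(q^(2k)−1)/q^(2k+1)`. beyond-print theorem: NO.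

References: [Cohen1975] Thm. 3.1; [Katz1973] §1.6 Cor. 1.6.2; crux notes `Lines/eisenstein-resource-bdp-line-w8g8-notes.md` §1 (composition
map), `…-w5g5-cusp-seed.md` §§14–15.
-/

-- summit-side namespace `Summit.BirchSwinnertonDyer.BirchSwinnertonDyer.…` (single-conjunct summit, D-0017 layout)
set_option linter.dupNamespace false

noncomputable section

open scoped Classical MatrixGroups NumberTheorySymbols ModularForm Manifold Topology Real

open UpperHalfPlane hiding I
open Complex Filter Function PowerSeries
open Literature.NumberTheory.EllipticCurves.ModularForms

namespace Summit.BirchSwinnertonDyer.BirchSwinnertonDyer.Theorems.PrintCFram.CuspGlue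

open Summit.BirchSwinnertonDyer.BirchSwinnertonDyer.Theorems.PrintCFram
open Literature.NumberTheory.EllipticCurves.Tunnell1983
open Literature.NumberTheory.ModularForms.CohenEisenstein (cohenH)
open Literature.NumberTheory.ModularForms

/-! ## §1 The kernel of a reduction map `ι : ℤ_p → 𝔽` -/

/-- For a ring map `ι : ℤ_p → 𝔽` into a non-trivial ring, `ι x = 0` forces `‖x‖ < 1` (a unit is not killed). [folklore] -/
theorem norm_lt_one_of_map_eq_zero {p : ℕ} [hp : Fact p.Prime] {𝔽 : Type*} [CommRing 𝔽] [Nontrivial 𝔽] (ι : ℤ_[p] →+* 𝔽)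
    {x : ℤ_[p]} (hx : ι x = 0) : ‖x‖ < 1 := by
  by_contra h
  have h1 : ‖x‖ = 1 := le_antisymm x.norm_le_one (not_lt.mp h)
  have hu : IsUnit x := PadicInt.isUnit_iff.mpr h1
  exact not_isUnit_zero (hx ▸ hu.map ι)

/-- For `G := −(Y.map ι)`: `G = 0` forces `‖coeff a Y‖ < 1` for every `a`. [folklore] -/
theorem norm_coeff_lt_one_of_neg_map_eq_zero {p : ℕ} [hp : Fact p.Prime] {𝔽 : Type*} [CommRing 𝔽] [Nontrivial 𝔽]
    (ι : ℤ_[p] →+* 𝔽) {Y : PowerSeries ℤ_[p]} (hG : -(PowerSeries.map ι Y) = 0) (a : ℕ) : ‖PowerSeries.coeff a Y‖ < 1 := by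
  apply norm_lt_one_of_map_eq_zero ι
  have := congr_arg (PowerSeries.coeff a) (neg_eq_zero.mp hG)
  simpa using this

/-! ## §2 `ℤ̄[1/N]`-bookkeeping: enlarging `N` -/

/-- If `M ∣ N` then «`M^j·x ∈ ℤ` for some `j`» implies «`N^j·x ∈ ℤ` for some `j`». [folklore] -/
theorem exists_pow_mul_eq_intCast_of_dvd {M N : ℕ} (hMN : M ∣ N) {x : ℚ} (h : ∃ (j : ℕ) (z : ℤ), (M : ℚ) ^ j * x = z) :
    ∃ (j : ℕ) (z : ℤ), (N : ℚ) ^ j * x = z := by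
  obtain ⟨c, rfl⟩ := hMN
  obtain ⟨j, z, hz⟩ := h
  refine ⟨j, c ^ j * z, ?_⟩
  push_cast
  rw [← hz, mul_pow]
  ring

/-! ## §3 The cusp conjunct from its sockets -/

/-- **THE CUSP CONJUNCT (iii) OF `stub_cuspCutForm` FROM ITS SOCKETS.** One class datum: `p ≥ 7` prime, `p ∤ m`, `2 ≤ k < p`; `𝔽` a field of
characteristic `p`, `ι : ℤ_p → 𝔽`; `Y ∈ ℤ_p⟦q⟧` lifting the Cohen numbers on the (3,0)-`m`-cut (`↑(coeff a Y) = H(k,a)`). LANDED inputs by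
name (NF-A via (δ), NF-Q via (γ), (α), (E4)); HYPOTHESES: (hINT) on the cut `‖H(k,a)‖_p < 1 ⟹ A·H(k,a) = p·y`, `2^j·y ∈ ℤ` for a fixed `A ≥ 1`,
`p ∤ A` (the conclusion of seat w7 g6's `CohenCut.exists_multiplier_eq_prime_mul_cut`, p697843); (hsum) the cut series `a(n) = [n ∈ cut]·H(k,n)` has `Σ a(n) n^{−s}` convergent for `s > k + 1/2` and (hR)
`(s − (k+1/2))·L(a,s) → R` (seat w5 g6); (hβ) «`Λ = i^{k+1} v`, `ℓ = Λ·√(2·(24m²)²)`, `((2π)^{k+1/2}/Γ(k+1/2))·ℓ = R` ⟹ `∃ u ≠ 0`,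
`v_p(u) = 0`, `v² = u·C²`» (seat w2 g13). CONCLUSION: `−(Y.map ι) = 0 → ∀ x : ℤ_[p], ↑x = ↑C → ι x = 0`, `C` the registered cusp constant.
Route: `G = 0` ⟹ `‖H(k,a)‖_p < 1` on the cut ⟹ (hINT) ⟹ (δ) the coefficients of `A • F` lie in `p·ℤ̄[1/N]` (`N = 4(24m²)⁴·2A`) ⟹ (γ) NF-Q at
the cusp `0`: `A·v = p·y` ⟹ [(δ) Lemma A, (α), (E4), `tendsto_nhds_unique` with (hR), (hβ)] `(A v)² = (A²u)·C²` ⟹ (γ) `cuspConjunct_of_sq_eq`.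
[cite: Cohen1975, Thm. 3.1] [cite: Katz1973, §1.6 Cor. 1.6.2] -/
theorem cuspConjunct_of_sockets
    (hA : Cohen1975.thm31_cohenSeries_mem_halfIntModularForms)
    (hQ : Katz1973_qExpansionPrinciple_allCusps)
    {p : ℕ} [hp : Fact p.Prime] {m : ℕ} [NeZero m] {k : ℕ} (h7 : 7 ≤ p) (hmp : m.Coprime p) (hk2 : 2 ≤ k)
    {𝔽 : Type*} [Field 𝔽] [CharP 𝔽 p] (ι : ℤ_[p] →+* 𝔽)
    {Y : PowerSeries ℤ_[p]}
    (hY : ∀ a : ℕ, (m ∣ a ∧ a / m % 4 = 3 ∧ (∀ q : ℕ, q.Prime → q ∣ m → q ≠ 2 → jacobiSym (-((a / m : ℕ) : ℤ)) q = 1) ∧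
        (2 ∣ m → a / m % 8 = 7) ∧ ¬ 3 ∣ a / m) → ((PowerSeries.coeff a Y : ℤ_[p]) : ℚ_[p]) = ((cohenH k a : ℚ) : ℚ_[p]))
    {A : ℕ} (hA0 : 0 < A) (hpA : ¬ p ∣ A)
    (hINT : ∀ a : ℕ, m ∣ a → a / m % 4 = 3 →
        (∀ q : ℕ, q.Prime → q ∣ m → q ≠ 2 → jacobiSym (-((a / m : ℕ) : ℤ)) q = 1) →
        ‖((cohenH k a : ℚ) : ℚ_[p])‖ < 1 →
        ∃ y : ℚ, (A : ℚ) * cohenH k a = p * y ∧ ∃ (j : ℕ) (z : ℤ), (2 : ℚ) ^ j * y = z)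
    (hsum : ∀ s : ℝ, (k : ℝ) + 1 / 2 < s → LSeriesSummable (fun a : ℕ ↦ if (m ∣ a ∧ a / m % 4 = 3 ∧
        (∀ q : ℕ, q.Prime → q ∣ m → q ≠ 2 → jacobiSym (-((a / m : ℕ) : ℤ)) q = 1) ∧
        (2 ∣ m → a / m % 8 = 7) ∧ ¬ 3 ∣ a / m) then ((cohenH k a : ℚ) : ℂ) else 0) s)
    {R : ℂ} (hR : Tendsto (fun s : ℝ ↦ ((s - ((k : ℝ) + 1 / 2) : ℝ) : ℂ) * LSeries (fun a : ℕ ↦ if (m ∣ a ∧ a / m % 4 = 3 ∧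
        (∀ q : ℕ, q.Prime → q ∣ m → q ≠ 2 → jacobiSym (-((a / m : ℕ) : ℤ)) q = 1) ∧
        (2 ∣ m → a / m % 8 = 7) ∧ ¬ 3 ∣ a / m) then ((cohenH k a : ℚ) : ℂ) else 0) s) (𝓝[>] ((k : ℝ) + 1 / 2)) (𝓝 R))
    (hβ : ∀ v Λ ℓ : ℂ, Λ = I ^ ((k + 1 : ℕ) : ℤ) * v → ℓ = Λ * (Real.sqrt (2 * ((24 * m ^ 2) ^ 2 : ℕ)) : ℂ) →
        (((2 * π) ^ ((k : ℝ) + 1 / 2) / Real.Gamma ((k : ℝ) + 1 / 2) : ℝ) : ℂ) * ℓ = R →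
        ∃ u : ℚ, u ≠ 0 ∧ padicValRat p u = 0 ∧ v ^ 2 = ((u * (bernoulli (2 * k) / (k.factorial : ℚ) * (m : ℚ) ^ (k - 1) *
          ∏ q ∈ m.primeFactors, ((q : ℚ) - 1) * ((q : ℚ) ^ (2 * k) - 1) / (q : ℚ) ^ (2 * k + 1)) ^ 2 : ℚ) : ℂ)) :
    -(PowerSeries.map ι Y) = 0 → ∀ x : ℤ_[p], (x : ℚ_[p]) =
      ((bernoulli (2 * k) / (k.factorial : ℚ) * (m : ℚ) ^ (k - 1) *
        ∏ q ∈ m.primeFactors, ((q : ℚ) - 1) * ((q : ℚ) ^ (2 * k) - 1) / (q : ℚ) ^ (2 * k + 1) : ℚ) : ℚ_[p]) → ι x = 0 := by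
  intro hG
  have hm : 0 < m := Nat.pos_of_ne_zero (NeZero.ne m)
  have hp0 : p ≠ 0 := hp.out.ne_zero
  -- abbreviations: the cut, the level, the enlarged `N`
  set S : ℕ → Prop := fun a ↦ m ∣ a ∧ a / m % 4 = 3 ∧
      (∀ q : ℕ, q.Prime → q ∣ m → q ≠ 2 → jacobiSym (-((a / m : ℕ) : ℤ)) q = 1) ∧
      (2 ∣ m → a / m % 8 = 7) ∧ ¬ 3 ∣ a / m with hS
  set L : ℕ := 4 * (24 * m ^ 2) ^ 2 * (24 * m ^ 2) ^ 2 with hL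
  set N : ℕ := L * (2 * A) with hN
  haveI : NeZero L := ⟨by rw [hL]; positivity⟩
  have hLN : L ∣ N := dvd_mul_right L (2 * A)
  have h2AN : 2 * A ∣ N := dvd_mul_left (2 * A) L
  have hN3 : 3 ≤ N := by
    have : 1 ≤ 2 * A := by omega
    have hL4 : 4 ≤ L := by
      rw [hL]; have : 1 ≤ (24 * m ^ 2) ^ 2 := Nat.one_le_pow _ _ (by positivity); nlinarith
    calc 3 ≤ 4 * 1 := by norm_num
      _ ≤ L * (2 * A) := Nat.mul_le_mul hL4 this
  have hcop : ∀ n : ℕ, ¬ p ∣ n → Nat.Coprime n p := fun n h ↦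
    Nat.coprime_comm.mp ((Nat.Prime.coprime_iff_not_dvd hp.out).mpr h)
  have hp2 : ¬ p ∣ 2 := fun h ↦ by have := Nat.le_of_dvd two_pos h; omega
  have hp3 : ¬ p ∣ 3 := fun h ↦ by have := Nat.le_of_dvd (by norm_num) h; omega
  have hpm : ¬ p ∣ m := fun h ↦ by
    have := Nat.Coprime.eq_one_of_dvd (Nat.Coprime.symm hmp) h
    omega
  have h24 : Nat.Coprime (24 * m ^ 2) p := by
    rw [show 24 * m ^ 2 = 2 ^ 3 * 3 * m ^ 2 by norm_num]
    exact Nat.Coprime.mul_left (Nat.Coprime.mul_left ((hcop 2 hp2).pow_left 3) (hcop 3 hp3)) ((hcop m hpm).pow_left 2)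
  have hNcop : Nat.Coprime N p := by
    rw [hN, hL, show (4 : ℕ) = 2 ^ 2 by norm_num]
    exact Nat.Coprime.mul_left (Nat.Coprime.mul_left (Nat.Coprime.mul_left ((hcop 2 hp2).pow_left 2) (h24.pow_left 2))
      (h24.pow_left 2)) (Nat.Coprime.mul_left (hcop 2 hp2) (hcop A hpA))
  have hpN : ¬ p ∣ N := fun h ↦ hp.out.one_lt.ne' (Nat.Coprime.eq_one_of_dvd (Nat.coprime_comm.mp hNcop) h)
  -- (δ) the cusp vehicle
  obtain ⟨F, r, -, -, -, hcoef, hfact, hLA⟩ :=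
    exists_cuspVehicle hA hm hk2 ⟨(k : ℝ) + 1, hsum _ (by linarith)⟩
  -- `G = 0` ⟹ `‖H(k,a)‖_p < 1` on the cut ⟹ (hINT) ⟹ the coefficients of `A • F` lie in `p · ℤ̄[1/N]`
  have hINT' : ∀ a : ℕ, (if S a then cohenH k a else 0) ≠ 0 →
      ∃ (j : ℕ) (z : ℤ), (N : ℚ) ^ j * ((A : ℚ) * (if S a then cohenH k a else 0) / p) = z := by
    intro a ha
    have hSa : S a := by by_contra h; exact ha (if_neg h)
    rw [if_pos hSa] at ha ⊢
    have hlt : ‖((cohenH k a : ℚ) : ℚ_[p])‖ < 1 := by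
      rw [← hY a hSa, ← PadicInt.norm_def]
      exact norm_coeff_lt_one_of_neg_map_eq_zero ι hG a
    obtain ⟨y, hy, j, z, hz⟩ := hINT a hSa.1 hSa.2.1 hSa.2.2.1 hlt
    refine exists_pow_mul_eq_intCast_of_dvd h2AN ?_
    obtain ⟨c, hc⟩ : 2 ∣ 2 * A := dvd_mul_right 2 A
    refine ⟨j, (c : ℤ) ^ j * z, ?_⟩
    have hp' : (p : ℚ) ≠ 0 := by exact_mod_cast hp0
    rw [show (A : ℚ) * cohenH k a / p = y by rw [hy]; field_simp, hc]
    push_cast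
    rw [← hz, mul_pow]
    ring
  have hcoefA := qExpansion_smul_coeff_mem F hcoef (A := A) (p := p) (N := N) hINT' hp0
  -- (γ) NF-Q at the cusp `0` for `A • F`
  obtain ⟨y₀, hy₀, hval⟩ := exists_isIntegral_valueAtInfty_slash_of_qExpansion_one hQ hLN hN3 ((A : ℝ) • F) p hcoefA ModularGroup.S
  rw [valueAtInfty_smul_slash F (A : ℝ)] at hval
  set v : ℂ := valueAtInfty (⇑F ∣[((k + 1 : ℕ) : ℤ)] ModularGroup.S) with hv
  -- the analytic chain: Lemma A ((δ)) ⟹ (α) ⟹ (E4), compared with (hR)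
  have ht : 0 < (24 * m ^ 2) ^ 2 := by positivity
  have hlim := tendsto_rpow_smul_tsum_of_eq_mul_thetaMul ht (k := ((k + 1 : ℕ) : ℤ))
    (Λ := I ^ ((k + 1 : ℕ) : ℤ) * v) (a := fun n : ℕ ↦ if S n then ((cohenH k n : ℚ) : ℂ) else 0) (F := ⇑F)
    (eventually_nhdsWithin_of_forall fun y hy ↦ hfact y hy) hLA
  have hw : ((((k + 1 : ℕ) : ℤ) : ℝ) - 1 / 2) = (k : ℝ) + 1 / 2 := by push_cast; ring
  rw [hw] at hlim
  have hwpos : 0 < (k : ℝ) + 1 / 2 := by positivity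
  have hE4 := CuspSeed.tendsto_sub_mul_LSeries_of_tendsto_rpow_smul_tsum hwpos hsum hlim
  have hE : (((2 * π) ^ ((k : ℝ) + 1 / 2) / Real.Gamma ((k : ℝ) + 1 / 2) : ℝ) : ℂ) *
      (I ^ ((k + 1 : ℕ) : ℤ) * v * (Real.sqrt (2 * ((24 * m ^ 2) ^ 2 : ℕ)) : ℂ)) = R :=
    tendsto_nhds_unique hE4 hR
  obtain ⟨u, hu0, hu, hsq⟩ := hβ v _ _ rfl rfl hE
  -- scale by `A` and conclude with (γ)
  have hA0' : (A : ℚ) ≠ 0 := by exact_mod_cast hA0.ne'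
  have hu0' : (A : ℚ) ^ 2 * u ≠ 0 := mul_ne_zero (pow_ne_zero _ hA0') hu0
  have huA : padicValRat p ((A : ℚ) ^ 2 * u) = 0 := by
    rw [padicValRat.mul (pow_ne_zero _ hA0') hu0, padicValRat.pow, hu,
      show ((A : ℚ)) = ((A : ℕ) : ℚ) by rfl, padicValRat.of_nat]
    simp [padicValNat.eq_zero_of_not_dvd hpA]
  have hsqA : ((A : ℂ) * v) ^ 2 = ((((A : ℚ) ^ 2 * u) * (bernoulli (2 * k) / (k.factorial : ℚ) * (m : ℚ) ^ (k - 1) *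
      ∏ q ∈ m.primeFactors, ((q : ℚ) - 1) * ((q : ℚ) ^ (2 * k) - 1) / (q : ℚ) ^ (2 * k + 1)) ^ 2 : ℚ) : ℂ) := by
    rw [mul_pow, hsq]
    push_cast
    ring
  exact cuspConjunct_of_sq_eq hpN ι hu0' huA hy₀ hval hsqA

/-! ## §4 The REGISTERED text of `stub_cuspCutForm` from its sockets

The three `G`-free analytic/arithmetic inputs are ONE hypothesis family `hAn` (per class datum: a residue `R` with (hsum) the
summability of the cut Cohen series for `s > k + 1/2`, (hR) its residue limit, and (hβ) the transcendental-constant implication) —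
discharged by seat w5 g6's (R2)/(R4) and seat w2 g13's (β) parts 2/3; (INT) is DISCHARGED here by seat w7 g6's landed
`CohenCut.exists_multiplier_eq_prime_mul_cut` (p697843); the support and dictionary conjuncts by seat w4 g12's
`CohenCut.cutForm_support_and_dictionary` at `(r, e) = (3, 0)` (`3^0 ∣ n ∧ ¬ 3^1 ∣ n ↔ ¬ 3 ∣ n`). -/

open DirichletCharacter Literature.NumberTheory.LFunctions Literature.NumberTheory.EllipticCurves
  Literature.NumberTheory.EllipticCurves.KrizLi2019 Literature.NumberTheory.QuadraticFields in
/-- **(CuspCutForm⁶) — the REGISTERED text of v24/v25's `stub_cuspCutForm` — from NF-A, NF-Q and the analytic hypothesis family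
`hAn`** (per class datum `∃ R`, (hsum) ∧ (hR) ∧ (hβ), in the currencies of seat w5 g6's `CuspSeed.tendsto_sub_mul_LSeries_ite_cut_cohenH`
/ `LSeriesSummable_ite_cut_cohenH` and seat w2 g13's `CuspGlue.exists_cuspUnit_sq_eq_of_sockets`), with `𝔽 := ZMod p`,
`ι := PadicInt.toZMod`, `G := −(Y.map ι)` for the `ℤ_p`-integral cut Cohen series `Y` of `CohenCut.cutForm_support_and_dictionary` at
`(r,e) = (3,0)`; (INT) discharged by `CohenCut.exists_multiplier_eq_prime_mul_cut`; (iii) by `cuspConjunct_of_sockets`.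
[cite: Cohen1975, Thm. 3.1] [cite: Katz1973, §1.6 Cor. 1.6.2] -/
theorem cuspCutForm_six_of_sockets
    (hA : Cohen1975.thm31_cohenSeries_mem_halfIntModularForms)
    (hQ : Katz1973_qExpansionPrinciple_allCusps)
    (hAn : ∀ (p : ℕ) [Fact p.Prime] (m : ℕ) [NeZero m] (χ : DirichletCharacter ℚ_[p] m) (k : ℕ),
      (p = 7 ∨ p = 11 ∨ p = 19 ∨ p = 43 ∨ p = 67 ∨ p = 163) →
      m.Coprime p → χ.IsPrimitive → χ.IsQuadratic → (k = (p + 1) / 4 ∨ k = (3 * p - 1) / 4) →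
      2 ≤ k → k ≤ p - 2 → χ (-1) * (-1) ^ k = -1 →
      ∃ R : ℂ,
        (∀ s : ℝ, (k : ℝ) + 1 / 2 < s → LSeriesSummable (fun a : ℕ ↦ if (m ∣ a ∧ a / m % 4 = 3 ∧
          (∀ q : ℕ, q.Prime → q ∣ m → q ≠ 2 → jacobiSym (-((a / m : ℕ) : ℤ)) q = 1) ∧
          (2 ∣ m → a / m % 8 = 7) ∧ ¬ 3 ∣ a / m) then ((cohenH k a : ℚ) : ℂ) else 0) s) ∧
        Tendsto (fun s : ℝ ↦ ((s - ((k : ℝ) + 1 / 2) : ℝ) : ℂ) * LSeries (fun a : ℕ ↦ if (m ∣ a ∧ a / m % 4 = 3 ∧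
          (∀ q : ℕ, q.Prime → q ∣ m → q ≠ 2 → jacobiSym (-((a / m : ℕ) : ℤ)) q = 1) ∧
          (2 ∣ m → a / m % 8 = 7) ∧ ¬ 3 ∣ a / m) then ((cohenH k a : ℚ) : ℂ) else 0) s)
          (𝓝[>] ((k : ℝ) + 1 / 2)) (𝓝 R) ∧
        (∀ v Λ ℓ : ℂ, Λ = I ^ ((k + 1 : ℕ) : ℤ) * v → ℓ = Λ * (Real.sqrt (2 * ((24 * m ^ 2) ^ 2 : ℕ)) : ℂ) →
          (((2 * π) ^ ((k : ℝ) + 1 / 2) / Real.Gamma ((k : ℝ) + 1 / 2) : ℝ) : ℂ) * ℓ = R →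
          ∃ u : ℚ, u ≠ 0 ∧ padicValRat p u = 0 ∧ v ^ 2 = ((u * (bernoulli (2 * k) / (k.factorial : ℚ) * (m : ℚ) ^ (k - 1) *
            ∏ q ∈ m.primeFactors, ((q : ℚ) - 1) * ((q : ℚ) ^ (2 * k) - 1) / (q : ℚ) ^ (2 * k + 1)) ^ 2 : ℚ) : ℂ))) :
    ∀ (p : ℕ) [Fact p.Prime] (m : ℕ) [NeZero m] (χ : DirichletCharacter ℚ_[p] m) (k : ℕ),
      (p = 7 ∨ p = 11 ∨ p = 19 ∨ p = 43 ∨ p = 67 ∨ p = 163) →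
      m.Coprime p → χ.IsPrimitive → χ.IsQuadratic → (k = (p + 1) / 4 ∨ k = (3 * p - 1) / 4) →
      2 ≤ k → k ≤ p - 2 → χ (-1) * (-1) ^ k = -1 →
      ∃ (𝔽 : Type) (_ : Field 𝔽) (_ : CharP 𝔽 p) (ι : ℤ_[p] →+* 𝔽) (G : PowerSeries 𝔽),
        (∀ a : ℕ, coeff a G ≠ 0 →
          m ∣ a ∧ a / m % 4 = 3 ∧ (∀ q : ℕ, q.Prime → q ∣ m → q ≠ 2 → jacobiSym (-((a / m : ℕ) : ℤ)) q = 1) ∧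
            (2 ∣ m → a / m % 8 = 7) ∧ ¬ 3 ∣ a / m) ∧
        (∀ (n₀ f : ℕ) (K : Type) [Field K] [NumberField K] (εK : DirichletCharacter ℚ_[p] (NumberField.discr K).natAbs),
          Squarefree n₀ → n₀ % 4 = 3 → 0 < f →
          (m ∣ m * (n₀ * f ^ 2) ∧ m * (n₀ * f ^ 2) / m % 4 = 3 ∧
            (∀ q : ℕ, q.Prime → q ∣ m → q ≠ 2 → jacobiSym (-((m * (n₀ * f ^ 2) / m : ℕ) : ℤ)) q = 1) ∧
            (2 ∣ m → m * (n₀ * f ^ 2) / m % 8 = 7) ∧ ¬ 3 ∣ m * (n₀ * f ^ 2) / m) →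
          IsImaginaryQuadratic K → NumberField.discr K = -(n₀ : ℤ) → IsKroneckerCharacterOf K εK →
          ∃ (t : ℤ) (x : ℤ_[p]), (f = 1 → t = 1) ∧
            (x : ℚ_[p]) = (k : ℚ_[p])⁻¹ * @generalizedBernoulli ℚ_[p] _ _
              (changeLevel (dvd_mul_right m (NumberField.discr K).natAbs) χ *
                changeLevel (dvd_mul_left (NumberField.discr K).natAbs m) εK).conductor ⟨conductor_ne_zero _⟩ k
              (changeLevel (dvd_mul_right m (NumberField.discr K).natAbs) χ *
                changeLevel (dvd_mul_left (NumberField.discr K).natAbs m) εK).primitiveCharacter ∧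
            coeff (m * (n₀ * f ^ 2)) G = (t : 𝔽) * ι x) ∧
        (G = 0 → ∀ x : ℤ_[p], (x : ℚ_[p]) =
          ((bernoulli (2 * k) / (k.factorial : ℚ) * (m : ℚ) ^ (k - 1) *
            ∏ q ∈ m.primeFactors, ((q : ℚ) - 1) * ((q : ℚ) ^ (2 * k) - 1) / (q : ℚ) ^ (2 * k + 1) : ℚ) : ℚ_[p]) →
          ι x = 0) := by
  intro p _ m _ χ k hp6 hmp hχ hχq hk hk2 hkp hpar
  have hp4 : p % 4 = 3 := by rcases hp6 with h | h | h | h | h | h <;> omega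
  have h7 : 7 ≤ p := by rcases hp6 with h | h | h | h | h | h <;> omega
  -- the ℤ_p-integral cut Cohen series at (r, e) = (3, 0) with its support/dictionary package (w4 g12)
  obtain ⟨Y, hYval, hYsd⟩ := CohenCut.cutForm_support_and_dictionary hp4 h7 hmp hχ hχq hk hpar 3 0
  -- (INT) (w7 g6)
  obtain ⟨A, hA0, hpA, hINT⟩ := CohenCut.exists_multiplier_eq_prime_mul_cut hp4 h7 hχ hχq hk hpar
  -- the analytic family
  obtain ⟨R, hsum, hR, hβ⟩ := hAn p m χ k hp6 hmp hχ hχq hk hk2 hkp hpar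
  -- the (3,0)-clause conversions
  have h30 : ∀ n : ℕ, (3 ^ 0 ∣ n ∧ ¬ 3 ^ (0 + 1) ∣ n) ↔ ¬ 3 ∣ n := fun n ↦ by simp
  obtain ⟨hsupp, hdict⟩ := hYsd (ZMod p) PadicInt.toZMod
  refine ⟨ZMod p, inferInstance, inferInstance, PadicInt.toZMod, -(PowerSeries.map PadicInt.toZMod Y), ?_, ?_, ?_⟩
  · -- (i) support
    intro a ha
    obtain ⟨h1, h2, h3, h4, h5⟩ := hsupp a ha
    exact ⟨h1, h2, h3, h4, (h30 _).mp h5⟩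
  · -- (ii) dictionary
    intro n₀ f K _ _ εK hsq hn4 hf hcut hK hdisc hεK
    obtain ⟨h1, h2, h3, h4, h5⟩ := hcut
    exact hdict n₀ f K εK hsq hn4 hf ⟨h1, h2, h3, h4, (h30 _).mpr h5⟩ hK hdisc hεK
  · -- (iii) the cusp conjunct (§3)
    exact cuspConjunct_of_sockets hA hQ h7 hmp hk2 PadicInt.toZMod
      (fun a ha ↦ hYval a ⟨ha.1, ha.2.1, ha.2.2.1, ha.2.2.2.1, (h30 _).mpr ha.2.2.2.2⟩) hA0 hpA hINT hsum hR hβ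

open DirichletCharacter Literature.NumberTheory.LFunctions Literature.NumberTheory.EllipticCurves
  Literature.NumberTheory.EllipticCurves.KrizLi2019 Literature.NumberTheory.QuadraticFields NumberField in
/-- **Certificate**: composing with `CuspSeed.cuspSeed_six_of_cutForm` (p688228, whose hypothesis IS the registered `stub_cuspCutForm`
text) typechecks — so `cuspCutForm_six_of_sockets` concludes v24/v25's `stub_cuspCutForm` VERBATIM, and (CuspSeed⁶) follows from
NF-A ∧ NF-Q ∧ `hAn`. [cite: Cohen1975, Thm. 3.1] [cite: Katz1973, §1.6 Cor. 1.6.2] -/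
theorem cuspSeed_six_of_sockets
    (hA : Cohen1975.thm31_cohenSeries_mem_halfIntModularForms)
    (hQ : Katz1973_qExpansionPrinciple_allCusps)
    (hAn : ∀ (p : ℕ) [Fact p.Prime] (m : ℕ) [NeZero m] (χ : DirichletCharacter ℚ_[p] m) (k : ℕ),
      (p = 7 ∨ p = 11 ∨ p = 19 ∨ p = 43 ∨ p = 67 ∨ p = 163) →
      m.Coprime p → χ.IsPrimitive → χ.IsQuadratic → (k = (p + 1) / 4 ∨ k = (3 * p - 1) / 4) →
      2 ≤ k → k ≤ p - 2 → χ (-1) * (-1) ^ k = -1 →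
      ∃ R : ℂ,
        (∀ s : ℝ, (k : ℝ) + 1 / 2 < s → LSeriesSummable (fun a : ℕ ↦ if (m ∣ a ∧ a / m % 4 = 3 ∧
          (∀ q : ℕ, q.Prime → q ∣ m → q ≠ 2 → jacobiSym (-((a / m : ℕ) : ℤ)) q = 1) ∧
          (2 ∣ m → a / m % 8 = 7) ∧ ¬ 3 ∣ a / m) then ((cohenH k a : ℚ) : ℂ) else 0) s) ∧
        Tendsto (fun s : ℝ ↦ ((s - ((k : ℝ) + 1 / 2) : ℝ) : ℂ) * LSeries (fun a : ℕ ↦ if (m ∣ a ∧ a / m % 4 = 3 ∧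
          (∀ q : ℕ, q.Prime → q ∣ m → q ≠ 2 → jacobiSym (-((a / m : ℕ) : ℤ)) q = 1) ∧
          (2 ∣ m → a / m % 8 = 7) ∧ ¬ 3 ∣ a / m) then ((cohenH k a : ℚ) : ℂ) else 0) s)
          (𝓝[>] ((k : ℝ) + 1 / 2)) (𝓝 R) ∧
        (∀ v Λ ℓ : ℂ, Λ = I ^ ((k + 1 : ℕ) : ℤ) * v → ℓ = Λ * (Real.sqrt (2 * ((24 * m ^ 2) ^ 2 : ℕ)) : ℂ) →
          (((2 * π) ^ ((k : ℝ) + 1 / 2) / Real.Gamma ((k : ℝ) + 1 / 2) : ℝ) : ℂ) * ℓ = R →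
          ∃ u : ℚ, u ≠ 0 ∧ padicValRat p u = 0 ∧ v ^ 2 = ((u * (bernoulli (2 * k) / (k.factorial : ℚ) * (m : ℚ) ^ (k - 1) *
            ∏ q ∈ m.primeFactors, ((q : ℚ) - 1) * ((q : ℚ) ^ (2 * k) - 1) / (q : ℚ) ^ (2 * k + 1)) ^ 2 : ℚ) : ℂ))) :
    ∀ (p : ℕ) [Fact p.Prime] (m : ℕ) [NeZero m] (χ : DirichletCharacter ℚ_[p] m) (k : ℕ),
      (p = 7 ∨ p = 11 ∨ p = 19 ∨ p = 43 ∨ p = 67 ∨ p = 163) →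
      m.Coprime p → χ.IsPrimitive → χ.IsQuadratic → (k = (p + 1) / 4 ∨ k = (3 * p - 1) / 4) →
      2 ≤ k → k ≤ p - 2 → χ (-1) * (-1) ^ k = -1 →
      ¬ (∃ ℓ : ℕ, ℓ.Prime ∧ ℓ ∣ m ∧ (ℓ % p = 1 ∨ ℓ % p = p - 1)) →
      ∃ (K₀ : Type) (_ : Field K₀) (_ : NumberField K₀) (ε₀ : DirichletCharacter ℚ_[p] (NumberField.discr K₀).natAbs),
        IsImaginaryQuadratic K₀ ∧
        (∀ q : ℕ, q.Prime → q ∣ m → ((Ideal.span {(q : ℤ)}).primesOver (𝓞 K₀)).ncard = 2) ∧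
        Odd (NumberField.discr K₀) ∧ NumberField.discr K₀ < -4 ∧ IsKroneckerCharacterOf K₀ ε₀ ∧
        ¬ ‖(k : ℚ_[p])⁻¹ * @generalizedBernoulli ℚ_[p] _ _
            (changeLevel (dvd_mul_right m (NumberField.discr K₀).natAbs) χ *
              changeLevel (dvd_mul_left (NumberField.discr K₀).natAbs m) ε₀).conductor ⟨conductor_ne_zero _⟩ k
            (changeLevel (dvd_mul_right m (NumberField.discr K₀).natAbs) χ *
              changeLevel (dvd_mul_left (NumberField.discr K₀).natAbs m) ε₀).primitiveCharacter‖ ≤ (p : ℝ)⁻¹ :=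
  CuspSeed.cuspSeed_six_of_cutForm (cuspCutForm_six_of_sockets hA hQ hAn)

end Summit.BirchSwinnertonDyer.BirchSwinnertonDyer.Theorems.PrintCFram.CuspGlue

end
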